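import Summits.BirchSwinnertonDyer.Rank1Residual.P2.CongruentNumberThetaThreePrimes
import HarnessLib
import HarnessLib.Audit.Tags

/-!
# Cell «bsd-monsky» (prover-B): route B's operator `θ` at `k = 3` — THEOREM B₃ for the type `(5, 5, 7)`, part 2
# (the recursion assembly, `g(2p₃)` even, THEOREM B₃ and the doors):
# `n = 2p₁p₂p₃`, `p₁ ≡ p₂ ≡ 5`, `p₃ ≡ 7 (mod 8)` ⟹ [`g(n) − 𝓛(p₁p₂)·g(2p₃)` odd ⟹ `𝓛(n)` odd], relative to the
# Literature display `tyz_cmPointGaloisData` and a rank input (kernel theorem; nothing asserted, nothing booked)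

HONEST FRAMING (cell `bsd-monsky`, run/shared/lean/pub/bsd-monsky/; README §1/§3): the cell's CLAIMED theorem is Monsky's
1990 conjecture on the `k = 2` family `𝒮⁻`; «ℓ ≥ 3 rungs (C-P2-2 for k ≥ 3) are NOT claimed — record what the same argument
gives there, no more». THIS FILE IS THAT RECORD IN THE KERNEL for the simplest `θ`-controlled `k = 3` type of the scope note
HOME/proof/PROOF-B-K3-SCOPE.md (prover-B g6; census kit j246343: type `[5,5,7]`). Nothing is asserted: every statement is
CONDITIONAL on TYZ data `D` with the displayed printed sentences (`D.Printed`, `D.CMPointGaloisPrinted` — the hypotheses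
the Literature named fact `tyz_cmPointGaloisData` provides) and on a rank input (GZK by name); no conjecture is discharged,
no count moves, no class is booked. NOT refereed; not part of PROOF-B v1.3 or of the paper.

THE TYPE. Primes `p₁ ≡ p₂ ≡ 5 (mod 8)` (`p₁ ≠ p₂`), `p₃ ≡ 7 (mod 8)`, `m = p₁p₂p₃ ≡ 7`, `n = 2m ≡ 6 (mod 8)`. TYZ's recursion
(`GenusPointData.recursion`, §3.1 p0011 L67–L70) has SIX blocks: `R(n) = {p₃, 2p₃, m}` (cofactors `2p₁p₂ ≡ 2`, `p₁p₂ ≡ 1`,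
`2`), `R(2p₃) = {p₃}`, `R(m) = {p₁, p₂, p₃}` (cofactors `p₂p₃ ≡ 3`, `p₁p₃ ≡ 3` — the `(5,3)`-steps with `ε = ±i` — and
`p₁p₂ ≡ 1`), `R(pᵢ) = ∅` (§2). With `θ = θ^{(n)}` the top block's lift of `σ_{1+ϖ}` (display (G8)):
(E6) `(θ−1)Z(n) ∈ g(n)w + ℤτ(1)` and `(θ−1)Z(2p₃) ∈ g(2p₃)w + ℤτ(1)` (`w = τ((1−i)/2)`; the sub-block by comparing `θ` with
the block's own lift `θ^{(2p₃)}` — `θ·(θ^{(2p₃)})⁻¹` is trivial on `L_{2p₃}(i) = ℚ(i, √2, √−p₃)`, J759); (E7) `θ` fixes `Z(p₃)`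
and `Z(m)` (Prop. 3.2 (3): `Z ∈ A(L_d)`, and `θ` is trivial on the genus field of `K_n`, which contains `L_{p₃}`, `L_m`);
(E5) `θZ(pᵢ) + Z(pᵢ) ∈ ℤτ(1)` for `i = 1, 2` (`θc` trivial on `L_{pᵢ}(i)`; PROOF-B (B3) = `reflection_sum_thetaPt`); the odd
powers of `[i]` at the `(5,3)`-steps turn `θ − 1` into `−[i](θ + 1)`. Hence (§4)
  `(θ − 1)P(n) = (g(n) − 𝓛(p₁p₂)·g(2p₃))·w + M·τ(1)`,
(THIS file, §3; the block evaluations are the package `theta_package_557` of part 1, `P2/CongruentNumberThetaThreePrimes.lean`)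
and the general descent core (`odd_scriptL_of_theta_rec`, file `…ThetaDescentCore`) gives THEOREM B₃ (§5):
  `g(n) − 𝓛(p₁p₂)·g(2p₃)` odd ⟹ `𝓛(n)` odd ⟹ `ord_{s=1} L(E_n, s) = 1`.
(`g(2p₃)` is even for `p₃ ≡ 7 (mod 8)` — Rédei; proved in the companion family file, where the hypothesis becomes `g(n)` odd
and is evaluated on Legendre symbols, and `BSD(E_n, 2)` follows through the landed even door.) The parity of TYZ's `Σ₂′(n)`
is NOT used: on the sub-family where `g(n)` is odd and `Σ₂′(n)` is even (census types `[5,5,7]/[0,1,0]`, `[0,0,1]`, smallest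
members `2030`, `8990`) no printed theorem decides `ord_{s=1} L(E_n, s)`; this file's theorem does, relative to the display.

References: [TianYuanZhang2017] §3.1 (J738–J739), Prop. 3.2 (1)(2)(3), Thm. 3.3 (ε), Thm. 3.5, Thm. 3.6 (1)(2) (J741),
Lemma 3.18, proofs of Lemma 3.15 (J750) and Lemma 3.21 (J759); HOME/proof/PROOF-B.md v1.3 §4–§8, §10;
HOME/proof/PROOF-B-K3-SCOPE.md §2–§4.
-/

noncomputable section

open scoped Classical

open WeierstrassCurve WeierstrassCurve.Affine Literature.NumberTheory.EllipticCurves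
  Literature.NumberTheory.EllipticCurves.Rank1Residual
  Literature.NumberTheory.EllipticCurves.Rank1Residual.Typed
  Literature.NumberTheory.EllipticCurves.HeathBrown1994
  Literature.NumberTheory.EllipticCurves.Tian2014
  Literature.NumberTheory.EllipticCurves.TianYuanZhang2017
  Literature.NumberTheory.EllipticCurves.TianYuanZhang2017.W2
  Literature.NumberTheory.QuadraticFields.RedeiReichardt

set_option autoImplicit false

namespace Summit.BirchSwinnertonDyer.Rank1Residual.P2

namespace ThetaDescent

variable {n : ℕ}

/-! ## §3 The six-block recursion under `θ − 1`: `(θ−1)P(n) = (g(n) − 𝓛(p₁p₂)·g(2p₃))·w + M·τ(1)` -/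

section Assembly

variable {p₁ p₂ p₃ : ℕ}

/-- Parity of `ε(d₀, d₁)`'s exponent from the printed rule: even unless `(d₀, d₁) ≡ (5, 3) (mod 8)`.
[cite: TianYuanZhang2017, Thm. 3.3 (p0011 L49–L51)] -/
theorem even_eps_of_not (D : GenusPointData n) (heps : D.epsSpec) {d₀ d₁ : ℕ} (h : ¬ (d₀ % 8 = 5 ∧ d₁ % 8 = 3)) :
    Even (D.eps d₀ d₁) := by
  rw [Nat.even_iff]
  by_contra hodd
  exact h ((heps d₀ d₁).mp (by omega))

/-- Parity of `ε(d₀, d₁)`'s exponent: odd when `(d₀, d₁) ≡ (5, 3) (mod 8)`. [cite: TianYuanZhang2017, Thm. 3.3 (p0011 L49–L51)] -/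
theorem odd_eps_of (D : GenusPointData n) (heps : D.epsSpec) {d₀ d₁ : ℕ} (h5 : d₀ % 8 = 5) (h3 : d₁ % 8 = 3) :
    Odd (D.eps d₀ d₁) :=
  Nat.odd_iff.mpr ((heps d₀ d₁).mpr ⟨h5, h3⟩)

/-- **The recursion side for the type `(5, 5, 7)`.** From the displayed `recursion` and `epsSpec` and the block evaluations
(E5), (E6), (E7) for an automorphism `θ` with `θ(i) = −i`:
`(θ − 1)P(n) = (g(n) − 𝓛(p₁p₂)·g(2p₃))·τ((1−i)/2) + M·τ(1)`. The six blocks: `P(pᵢ) = Z(pᵢ)`; `P(2p₃) = Z(2p₃) −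
ε𝓛(2)Z(p₃)` (`ε = ±1`); `P(m) = Z(m) − ε𝓛(p₁p₂)Z(p₃) − ε′𝓛(p₂p₃)Z(p₁) − ε″𝓛(p₁p₃)Z(p₂)` (`ε′, ε″ = ±i`: `(θ−1)∘[i] =
−[i]∘(θ+1)`); `P(n) = Z(n) − ε𝓛(2p₁p₂)P(p₃) − ε𝓛(p₁p₂)P(2p₃) − ε𝓛(2)P(m)` (`ε = ±1`).
[cite: TianYuanZhang2017, §3.1 (p0011 L67–L73), Thm. 3.3 (p0011 L49–L51)] -/
theorem theta_sub_P_557 (hp₁ : p₁.Prime) (hp₂ : p₂.Prime) (hp₃ : p₃.Prime) (h₁ : p₁ % 8 = 5) (h₂ : p₂ % 8 = 5)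
    (h₃ : p₃ % 8 = 7) (D : GenusPointData (2 * (p₁ * p₂ * p₃))) (hrec : D.recursion) (heps : D.epsSpec)
    (θ : D.H ≃ₐ[ℚ] D.H) (hθi : θ D.im = -D.im)
    (hZn : ∃ M : ℤ, thetaPt D θ (D.Z (2 * (p₁ * p₂ * p₃))) - D.Z (2 * (p₁ * p₂ * p₃)) =
        (gK (2 * (p₁ * p₂ * p₃)) : ℤ) • D.tauHalfOneMinusI + M • tauOne)
    (hZ2p₃ : ∃ M : ℤ, thetaPt D θ (D.Z (2 * p₃)) - D.Z (2 * p₃) = (gK (2 * p₃) : ℤ) • D.tauHalfOneMinusI + M • tauOne)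
    (hZp₃ : thetaPt D θ (D.Z p₃) = D.Z p₃) (hZm : thetaPt D θ (D.Z (p₁ * p₂ * p₃)) = D.Z (p₁ * p₂ * p₃))
    (hZp₁ : thetaPt D θ (D.Z p₁) + D.Z p₁ ∈ AddSubgroup.zmultiples (tauOne : APoint D.H))
    (hZp₂ : thetaPt D θ (D.Z p₂) + D.Z p₂ ∈ AddSubgroup.zmultiples (tauOne : APoint D.H)) :
    ∃ M : ℤ, thetaPt D θ (D.P (2 * (p₁ * p₂ * p₃))) - D.P (2 * (p₁ * p₂ * p₃)) =
      ((gK (2 * (p₁ * p₂ * p₃)) : ℤ) - D.scriptL (p₁ * p₂) * (gK (2 * p₃) : ℤ)) • D.tauHalfOneMinusI + M • tauOne := by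
  -- arithmetic
  have h12m : (p₁ * p₂) % 8 = 1 := by rw [Nat.mul_mod, h₁, h₂]
  have h13m : (p₁ * p₃) % 8 = 3 := by rw [Nat.mul_mod, h₁, h₃]
  have h23m : (p₂ * p₃) % 8 = 3 := by rw [Nat.mul_mod, h₂, h₃]
  have hm7 : (p₁ * p₂ * p₃) % 8 = 7 := by rw [Nat.mul_mod, h12m, h₃]
  have hn6 : (2 * (p₁ * p₂ * p₃)) % 8 = 6 := by omega
  have h2p₃ : (2 * p₃) % 8 = 6 := by omega
  have h13 : p₁ ≠ p₃ := fun h => by omega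
  have h23 : p₂ ≠ p₃ := fun h => by omega
  have hm0 : p₁ * p₂ * p₃ ≠ 0 := Nat.mul_ne_zero (Nat.mul_ne_zero hp₁.ne_zero hp₂.ne_zero) hp₃.ne_zero
  have hn0 : 2 * (p₁ * p₂ * p₃) ≠ 0 := Nat.mul_ne_zero two_ne_zero hm0
  have hn : 2 * (p₁ * p₂ * p₃) ∈ (2 * (p₁ * p₂ * p₃)).divisors := Nat.mem_divisors_self _ hn0
  have hp₁n : p₁ ∈ (2 * (p₁ * p₂ * p₃)).divisors := Nat.mem_divisors.mpr ⟨Dvd.intro (2 * (p₂ * p₃)) (by ring), hn0⟩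
  have hp₂n : p₂ ∈ (2 * (p₁ * p₂ * p₃)).divisors := Nat.mem_divisors.mpr ⟨Dvd.intro (2 * (p₁ * p₃)) (by ring), hn0⟩
  have hp₃n : p₃ ∈ (2 * (p₁ * p₂ * p₃)).divisors := Nat.mem_divisors.mpr ⟨Dvd.intro (2 * (p₁ * p₂)) (by ring), hn0⟩
  have hmn : p₁ * p₂ * p₃ ∈ (2 * (p₁ * p₂ * p₃)).divisors := Nat.mem_divisors.mpr ⟨Dvd.intro 2 (by ring), hn0⟩
  have h2p₃n : 2 * p₃ ∈ (2 * (p₁ * p₂ * p₃)).divisors := Nat.mem_divisors.mpr ⟨Dvd.intro (p₁ * p₂) (by ring), hn0⟩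
  -- quotients
  have qmp₁ : p₁ * p₂ * p₃ / p₁ = p₂ * p₃ := by
    rw [show p₁ * p₂ * p₃ = p₁ * (p₂ * p₃) by ring]; exact Nat.mul_div_cancel_left _ hp₁.pos
  have qmp₂ : p₁ * p₂ * p₃ / p₂ = p₁ * p₃ := by
    rw [show p₁ * p₂ * p₃ = p₂ * (p₁ * p₃) by ring]; exact Nat.mul_div_cancel_left _ hp₂.pos
  have qmp₃ : p₁ * p₂ * p₃ / p₃ = p₁ * p₂ := Nat.mul_div_cancel _ hp₃.pos
  have q2p₃ : 2 * p₃ / p₃ = 2 := Nat.mul_div_cancel _ hp₃.pos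
  have qnp₃ : 2 * (p₁ * p₂ * p₃) / p₃ = 2 * (p₁ * p₂) := by
    rw [show 2 * (p₁ * p₂ * p₃) = 2 * (p₁ * p₂) * p₃ by ring]; exact Nat.mul_div_cancel _ hp₃.pos
  have qn2p₃ : 2 * (p₁ * p₂ * p₃) / (2 * p₃) = p₁ * p₂ := by
    rw [show 2 * (p₁ * p₂ * p₃) = (2 * p₃) * (p₁ * p₂) by ring]; exact Nat.mul_div_cancel_left _ (by omega)
  have qnm : 2 * (p₁ * p₂ * p₃) / (p₁ * p₂ * p₃) = 2 := Nat.mul_div_cancel _ (Nat.pos_of_ne_zero hm0)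
  -- the subgroup `ℤτ(1)`
  set S : AddSubgroup (APoint D.H) := AddSubgroup.zmultiples (tauOne : APoint D.H) with hS
  have hτS : (tauOne : APoint D.H) ∈ S := AddSubgroup.mem_zmultiples _
  -- the prime blocks: `P(pᵢ) = Z(pᵢ)`
  have hPp₁ : D.P p₁ = D.Z p₁ := by
    have h := hrec p₁ hp₁n (Or.inl h₁)
    rwa [recursionIndex_prime hp₁, Finset.sum_empty, sub_zero] at h
  have hPp₂ : D.P p₂ = D.Z p₂ := by
    have h := hrec p₂ hp₂n (Or.inl h₂)
    rwa [recursionIndex_prime hp₂, Finset.sum_empty, sub_zero] at h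
  have hPp₃ : D.P p₃ = D.Z p₃ := by
    have h := hrec p₃ hp₃n (Or.inr (Or.inr h₃))
    rwa [recursionIndex_prime hp₃, Finset.sum_empty, sub_zero] at h
  have hDp₃ : thetaPt D θ (D.P p₃) - D.P p₃ = 0 := by rw [hPp₃, hZp₃, sub_self]
  -- the block `2p₃`
  obtain ⟨M₂, hM₂⟩ := hZ2p₃
  have hD2p₃ : thetaPt D θ (D.P (2 * p₃)) - D.P (2 * p₃) = (gK (2 * p₃) : ℤ) • D.tauHalfOneMinusI + M₂ • tauOne := by
    have h := hrec (2 * p₃) h2p₃n (Or.inr (Or.inl h2p₃))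
    rw [recursionIndex_two_mul_seven hp₃ h₃, Finset.sum_singleton, q2p₃] at h
    have he : Even (D.eps p₃ 2) := even_eps_of_not D heps (by omega)
    rw [h, map_sub, sub_sub_sub_comm, theta_sub_cmIPow_even D θ hθi he, hDp₃, smul_zero, map_zero, sub_zero, hM₂]
  -- the block `m`
  have hDm : thetaPt D θ (D.P (p₁ * p₂ * p₃)) - D.P (p₁ * p₂ * p₃) ∈ S := by
    have h := hrec (p₁ * p₂ * p₃) hmn (Or.inr (Or.inr hm7))
    rw [h, map_sub, sub_sub_sub_comm, hZm, sub_self, zero_sub, map_sum, ← Finset.sum_sub_distrib]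
    refine S.neg_mem (sum_mem fun d₀ hd₀ => ?_)
    rcases mem_recursionIndex_m hp₁ hp₂ hp₃ h₁ h₂ h₃ hd₀ with rfl | rfl | rfl
    · rw [qmp₁, theta_sub_cmIPow_odd D θ hθi (odd_eps_of D heps h₁ h23m), hPp₁]
      exact S.neg_mem (cmIPow_mem_zmultiples_tauOne D (S.zsmul_mem hZp₁ _) _)
    · rw [qmp₂, theta_sub_cmIPow_odd D θ hθi (odd_eps_of D heps h₂ h13m), hPp₂]
      exact S.neg_mem (cmIPow_mem_zmultiples_tauOne D (S.zsmul_mem hZp₂ _) _)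
    · rw [qmp₃, theta_sub_cmIPow_even D θ hθi (even_eps_of_not D heps (by omega)), hDp₃, smul_zero, map_zero]
      exact S.zero_mem
  -- the top block
  obtain ⟨M₀, hM₀⟩ := hZn
  have hrecn := hrec (2 * (p₁ * p₂ * p₃)) hn (Or.inr (Or.inl hn6))
  have hsplit := Finset.add_sum_erase (recursionIndex (2 * (p₁ * p₂ * p₃)))
    (fun d₀ => cmIPow D.im D.im_sq (D.eps d₀ (2 * (p₁ * p₂ * p₃) / d₀))
      (D.scriptL (2 * (p₁ * p₂ * p₃) / d₀) • D.P d₀))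
    (two_mul_mem_recursionIndex_n hp₁ hp₂ hp₃ h₁ h₂ h₃)
  -- the erased sum is `θ`-stable modulo `ℤτ(1)`
  have hErase : thetaPt D θ (∑ d₀ ∈ (recursionIndex (2 * (p₁ * p₂ * p₃))).erase (2 * p₃),
      cmIPow D.im D.im_sq (D.eps d₀ (2 * (p₁ * p₂ * p₃) / d₀)) (D.scriptL (2 * (p₁ * p₂ * p₃) / d₀) • D.P d₀)) -
      ∑ d₀ ∈ (recursionIndex (2 * (p₁ * p₂ * p₃))).erase (2 * p₃),
      cmIPow D.im D.im_sq (D.eps d₀ (2 * (p₁ * p₂ * p₃) / d₀)) (D.scriptL (2 * (p₁ * p₂ * p₃) / d₀) • D.P d₀) ∈ S := by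
    rw [map_sum, ← Finset.sum_sub_distrib]
    refine sum_mem fun d₀ hd₀ => ?_
    obtain ⟨hne, hd₀'⟩ := Finset.mem_erase.mp hd₀
    rcases mem_recursionIndex_n hp₁ hp₂ hp₃ h₁ h₂ h₃ hd₀' with rfl | rfl | rfl
    · rw [qnp₃, theta_sub_cmIPow_even D θ hθi (even_eps_of_not D heps (by omega)), hDp₃, smul_zero, map_zero]
      exact S.zero_mem
    · exact absurd rfl hne
    · rw [qnm, theta_sub_cmIPow_even D θ hθi (even_eps_of_not D heps (by omega))]
      exact cmIPow_mem_zmultiples_tauOne D (S.zsmul_mem hDm _) _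
  obtain ⟨K, hK⟩ := exists_eq_zsmul_of_mem_zmultiples_tauOne D hErase
  -- the `2p₃` term
  have he₂ : Even (D.eps (2 * p₃) (p₁ * p₂)) := even_eps_of_not D heps (by omega)
  obtain ⟨j, hj⟩ := cmIPow_tauHalfOneMinusI D (D.eps (2 * p₃) (p₁ * p₂))
  refine ⟨M₀ - (D.scriptL (p₁ * p₂) * (gK (2 * p₃) : ℤ) * j + D.scriptL (p₁ * p₂) * M₂) - K, ?_⟩
  rw [hrecn, ← hsplit, map_sub, map_add, qn2p₃, sub_sub_sub_comm, hM₀, add_sub_add_comm, hK,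
    theta_sub_cmIPow_even D θ hθi he₂, hD2p₃, smul_add, smul_smul, smul_smul, map_add, map_zsmul, map_zsmul, hj,
    cmIPow_tauOne]
  module

end Assembly

/-! ## §4 `g(2p₃)` is even (Rédei, `t = 2`): the criterion's coefficient `𝓛(p₁p₂)·g(2p₃)` is even -/

section Redei

variable {p₃ : ℕ}

/-- **`g(2p)` is EVEN for a prime `p ≡ 7 (mod 8)`** (`K = ℚ(√−2p)`, `t = 2`, the Rédei matrix on `(2, p)` vanishes:
`(−p/2)`: `−p ≡ 1 (mod 8)`; `(8/p) = (2/p) = +1`; so the `4`-rank is `1`), modulo Rédei–Reichardt instantiated by the tree's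
theorem `redeiReichardt_fourTwoCard_classGroup_holds`. [cite: LiMa2008, Thm. 0.4 with Lemma 0.1]
[cite: TianYuanZhang2017, §1 (p0002 L78–L82: g(d))] -/
theorem not_odd_gK_two_mul_of_seven_mod_eight (hp : p₃.Prime) (h7 : p₃ % 8 = 7) : ¬ Odd (gK (2 * p₃)) := by
  have hp2 : p₃ ≠ 2 := by omega
  have hprod : ∏ i, (![2, p₃] : Fin 2 → ℕ) i = if (2 * p₃) % 4 = 1 then 2 * (2 * p₃) else 2 * p₃ := by
    rw [if_neg (by omega)]; simp [Fin.prod_univ_two]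
  have hinj : Function.Injective (![2, p₃] : Fin 2 → ℕ) := by
    intro i j h
    fin_cases i <;> fin_cases j <;> simp_all [hp2.symm]
  unfold gK
  rw [odd_genusClassNumber_genusField_iff_card_ker redeiReichardt_fourTwoCard_classGroup_holds (ι := Fin 2) ![2, p₃]
    (fun i => by fin_cases i <;> [exact Nat.prime_two; exact hp]) hinj hprod]
  have hD2 : primeDisc (2 * p₃) 2 = 8 := primeDisc_two_mul_two_of_mod_four_three (by omega)
  have hb1 : kroneckerBit (primeDisc (2 * p₃) p₃) 2 = 0 := by
    rw [kroneckerBit_primeDisc_two hp hp2]; unfold chi8Bit; rw [if_neg (by omega)]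
  have hb2 : kroneckerBit (primeDisc (2 * p₃) 2) p₃ = 0 := by
    rw [hD2]; exact kroneckerBit_eight_eq_zero hp (Or.inr h7)
  have e : (Matrix.of fun a b : Fin 2 =>
      if a = b then ∑ c ∈ Finset.univ.erase a, kroneckerBit (primeDisc (2 * p₃) ((![2, p₃] : Fin 2 → ℕ) c))
        ((![2, p₃] : Fin 2 → ℕ) a)
      else kroneckerBit (primeDisc (2 * p₃) ((![2, p₃] : Fin 2 → ℕ) b)) ((![2, p₃] : Fin 2 → ℕ) a)) =
      !![0, 0; 0, 0] := by
    ext a b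
    fin_cases a <;> fin_cases b <;> simp [hb1, hb2]
  rw [e]
  decide

end Redei

/-! ## §5 THEOREM B₃ and the doors -/

section Doors

variable {p₁ p₂ p₃ : ℕ}

/-- `n = 2p₁p₂p₃` is square-free for pairwise distinct odd primes. [cite: HardyWright2008, §1.3 Thm. 2] -/
theorem squarefree_two_mul_557 (hp₁ : p₁.Prime) (hp₂ : p₂.Prime) (hp₃ : p₃.Prime) (h₁ : p₁ % 8 = 5) (h₂ : p₂ % 8 = 5)
    (h₃ : p₃ % 8 = 7) (h12 : p₁ ≠ p₂) : Squarefree (2 * (p₁ * p₂ * p₃)) := by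
  have ht : ∀ i, ((![p₁, p₂, p₃] : Fin 3 → ℕ) i).Prime := fun i => by fin_cases i <;> assumption
  have hodd : ∀ i, Odd ((![p₁, p₂, p₃] : Fin 3 → ℕ) i) := fun i => by
    fin_cases i <;> exact Nat.odd_iff.mpr (by simp; omega)
  have h13 : p₁ ≠ p₃ := fun h => by omega
  have h23 : p₂ ≠ p₃ := fun h => by omega
  have hinj : Function.Injective (![p₁, p₂, p₃] : Fin 3 → ℕ) := by
    intro i j h
    fin_cases i <;> fin_cases j <;> simp_all
  have h := squarefree_two_mul_prod_of_injective _ ht hodd hinj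
  rwa [Fin.prod_univ_three] at h

/-- **THEOREM B₃ (type `(5, 5, 7)`) in the kernel, modulo the display and a rank input.** For primes `p₁ ≡ p₂ ≡ 5`,
`p₃ ≡ 7 (mod 8)`, `p₁ ≠ p₂`, TYZ data `D` for `n = 2p₁p₂p₃` with `D.Printed` and `D.CMPointGaloisPrinted`, and rank
`E_n(ℚ) ≤ 1` once `𝓛(n) ≠ 0` (`hr`): if `g(n) = #2Cl(ℚ(√−n))` is ODD then `𝓛(n)` (the data's sign choice) is ODD.
(`(θ−1)P(n) ∈ (g(n) − 𝓛(p₁p₂)g(2p₃))·w + ℤτ(1)` with `g(2p₃)` even; then the general descent core.)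
[cite: TianYuanZhang2017, Thm. 3.5 (p0011 L94–L112), Thm. 3.6 (2) (J741), Lemma 3.18, §3.1 (p0011 L67–L73), proof of Lemma 3.21 (J759)]
[cite: LiMa2008, Thm. 0.4] -/
theorem odd_scriptL_two_mul_557 (hp₁ : p₁.Prime) (hp₂ : p₂.Prime) (hp₃ : p₃.Prime) (h₁ : p₁ % 8 = 5)
    (h₂ : p₂ % 8 = 5) (h₃ : p₃ % 8 = 7) (h12 : p₁ ≠ p₂) (D : GenusPointData (2 * (p₁ * p₂ * p₃))) (hD : D.Printed)
    (hG : D.CMPointGaloisPrinted)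
    (hr :
      letI := isElliptic_congruentNumberCurve (squarefree_two_mul_557 hp₁ hp₂ hp₃ h₁ h₂ h₃ h12).ne_zero
      D.scriptL (2 * (p₁ * p₂ * p₃)) ≠ 0 → (congruentNumberCurve (2 * (p₁ * p₂ * p₃))).mordellWeilRank ≤ 1)
    (hg : Odd (gK (2 * (p₁ * p₂ * p₃)))) : Odd (D.scriptL (2 * (p₁ * p₂ * p₃))) := by
  have hsq := squarefree_two_mul_557 hp₁ hp₂ hp₃ h₁ h₂ h₃ h12
  have h12m : (p₁ * p₂) % 8 = 1 := by rw [Nat.mul_mod, h₁, h₂]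
  have hm7 : (p₁ * p₂ * p₃) % 8 = 7 := by rw [Nat.mul_mod, h12m, h₃]
  have hn6 : (2 * (p₁ * p₂ * p₃)) % 8 = 6 := by omega
  obtain ⟨hLspec, heps, hrec, -, h35, -, -, -, h318, -, -⟩ := hD
  obtain ⟨θ, hθK, hθi, hθ2, hZn, hZ2p₃, hZp₃, hZm, hZp₁, hZp₂⟩ := theta_package_557 hp₁ hp₂ hp₃ h₁ h₂ h₃ D hG
  obtain ⟨M, hM⟩ := theta_sub_P_557 hp₁ hp₂ hp₃ h₁ h₂ h₃ D hrec heps θ hθi hZn hZ2p₃ hZp₃ hZm hZp₁ hZp₂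
  obtain ⟨hw2, hww⟩ := bZero D θ hθi
  -- `g(2p₃)` even, so the coefficient is odd iff `g(n)` is
  have hG : Odd ((gK (2 * (p₁ * p₂ * p₃)) : ℤ) - D.scriptL (p₁ * p₂) * (gK (2 * p₃) : ℤ)) := by
    have he : Even (gK (2 * p₃)) := Nat.not_odd_iff_even.mp (not_odd_gK_two_mul_of_seven_mod_eight hp₃ h₃)
    have he' : Even (D.scriptL (p₁ * p₂) * (gK (2 * p₃) : ℤ)) := ((Int.even_coe_nat _).mpr he).mul_left _
    exact ((Int.odd_coe_nat _).mpr hg).sub_even he'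
  exact odd_scriptL_of_theta_rec hsq hn6 D hLspec h35 h318 hr θ hθK hθi hθ2 (Or.inl hw2) hww hM hG

/-- **`𝓛(n) ≠ 0` for the type `(5, 5, 7)` with `g(n)` odd — NO rank input** (if `𝓛(n) = 0` the rank hypothesis of
`odd_scriptL_two_mul_557` is vacuous). Hence clause (a) below from the display ALONE.
[cite: TianYuanZhang2017, Thm. 3.5 (p0011 L94–L95: 𝓛(n) = 0 ⟹ 𝒫(n) = 0), Lemma 3.18] -/
theorem scriptL_ne_zero_two_mul_557 (hp₁ : p₁.Prime) (hp₂ : p₂.Prime) (hp₃ : p₃.Prime) (h₁ : p₁ % 8 = 5)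
    (h₂ : p₂ % 8 = 5) (h₃ : p₃ % 8 = 7) (h12 : p₁ ≠ p₂) (D : GenusPointData (2 * (p₁ * p₂ * p₃))) (hD : D.Printed)
    (hG : D.CMPointGaloisPrinted) (hg : Odd (gK (2 * (p₁ * p₂ * p₃)))) : D.scriptL (2 * (p₁ * p₂ * p₃)) ≠ 0 := by
  intro h0
  have h := odd_scriptL_two_mul_557 hp₁ hp₂ hp₃ h₁ h₂ h₃ h12 D hD hG (fun h => absurd h0 h) hg
  rw [h0] at h
  exact (Int.not_odd_iff_even.mpr (Even.zero)) h

/-- **Clause (a) for the type `(5, 5, 7)` with `g(n)` odd, from the Literature display ALONE**: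
`ord_{s=1} L(E_n, s) = 1` (root number `−1` and `𝓛(n) ≠ 0`). No GZK, no Selmer input, no genus-sum hypothesis.
CONDITIONAL on `tyz_cmPointGaloisData`; nothing asserted.
[cite: TianYuanZhang2017, §1 (definition of 𝓛(n), p0002 L46–L75), §3] -/
theorem analyticRank_eq_one_two_mul_557_of_cmPointGaloisData (hCM : tyz_cmPointGaloisData) (hp₁ : p₁.Prime)
    (hp₂ : p₂.Prime) (hp₃ : p₃.Prime) (h₁ : p₁ % 8 = 5) (h₂ : p₂ % 8 = 5) (h₃ : p₃ % 8 = 7) (h12 : p₁ ≠ p₂)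
    (hg : Odd (gK (2 * (p₁ * p₂ * p₃)))) : (congruentNumberCurve (2 * (p₁ * p₂ * p₃))).analyticRank = 1 := by
  have hsq := squarefree_two_mul_557 hp₁ hp₂ hp₃ h₁ h₂ h₃ h12
  have h12m : (p₁ * p₂) % 8 = 1 := by rw [Nat.mul_mod, h₁, h₂]
  have hm7 : (p₁ * p₂ * p₃) % 8 = 7 := by rw [Nat.mul_mod, h12m, h₃]
  have hn6 : (2 * (p₁ * p₂ * p₃)) % 8 = 6 := by omega
  obtain ⟨D, hD, hG⟩ := hCM _ hsq (Or.inr (Or.inl hn6))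
  have hL : IsScriptL _ (D.scriptL (2 * (p₁ * p₂ * p₃))) := hD.1 _ (Nat.mem_divisors_self _ hsq.ne_zero) (by omega)
  exact analyticRank_congruentNumberCurve_eq_one_of_isScriptL hsq (Or.inr (Or.inl hn6)) hL
    (scriptL_ne_zero_two_mul_557 hp₁ hp₂ hp₃ h₁ h₂ h₃ h12 D hD hG hg)

/-- **THEOREM B₃, output shape**: for the type `(5, 5, 7)` with `g(n)` odd there is an ODD integer `L` with `L² = 𝓛(n)²`,
relative to {`tyz_cmPointGaloisData`, GZK}. CONDITIONAL; nothing asserted.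
[cite: TianYuanZhang2017, Thm. 3.5 and §3] -/
theorem exists_odd_isScriptL_two_mul_557_of_cmPointGaloisData (hCM : tyz_cmPointGaloisData)
    (hGZK : rank_eq_analyticRank_of_analyticRank_le_one) (hp₁ : p₁.Prime) (hp₂ : p₂.Prime) (hp₃ : p₃.Prime)
    (h₁ : p₁ % 8 = 5) (h₂ : p₂ % 8 = 5) (h₃ : p₃ % 8 = 7) (h12 : p₁ ≠ p₂) (hg : Odd (gK (2 * (p₁ * p₂ * p₃)))) :
    ∃ L : ℤ, Odd L ∧ IsScriptL (2 * (p₁ * p₂ * p₃)) L := by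
  have hsq := squarefree_two_mul_557 hp₁ hp₂ hp₃ h₁ h₂ h₃ h12
  haveI := isElliptic_congruentNumberCurve hsq.ne_zero
  have h12m : (p₁ * p₂) % 8 = 1 := by rw [Nat.mul_mod, h₁, h₂]
  have hm7 : (p₁ * p₂ * p₃) % 8 = 7 := by rw [Nat.mul_mod, h12m, h₃]
  have hn6 : (2 * (p₁ * p₂ * p₃)) % 8 = 6 := by omega
  obtain ⟨D, hD, hG⟩ := hCM _ hsq (Or.inr (Or.inl hn6))
  have hL : IsScriptL _ (D.scriptL (2 * (p₁ * p₂ * p₃))) := hD.1 _ (Nat.mem_divisors_self _ hsq.ne_zero) (by omega)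
  refine ⟨_, odd_scriptL_two_mul_557 hp₁ hp₂ hp₃ h₁ h₂ h₃ h12 D hD hG (fun hL0 => ?_) hg, hL⟩
  have har := S4 hsq (Or.inr (Or.inl hn6)) hL hL0
  rw [(hGZK (congruentNumberCurve _) har).1]; exact har

/-- **The rank-one datum of the type `(5, 5, 7)` with `g(n)` odd**: `ord_{s=1} L(E_n, s) = 1` and
`L′(E_n, 1) = x·Ω(E_n)·Reg(E_n(ℚ))` with `x = 2⁴·L²`, `L` odd, so `ord₂ x = 4` (TYZ (1.1) read in the tree:
`leadingLCoeff_congruentNumberCurve_eq_of_isScriptL`, `twoExponent (2p₁p₂p₃) = 2·3 − 2`). Relative to {`tyz_cmPointGaloisData`,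
GZK}; nothing asserted. [cite: TianYuanZhang2017, §1 ((1.1), p0002 L63–L75)] -/
theorem rankOneDatum_two_mul_557_of_cmPointGaloisData (hCM : tyz_cmPointGaloisData)
    (hGZK : rank_eq_analyticRank_of_analyticRank_le_one) (hp₁ : p₁.Prime) (hp₂ : p₂.Prime) (hp₃ : p₃.Prime)
    (h₁ : p₁ % 8 = 5) (h₂ : p₂ % 8 = 5) (h₃ : p₃ % 8 = 7) (h12 : p₁ ≠ p₂) (hg : Odd (gK (2 * (p₁ * p₂ * p₃)))) :
    (congruentNumberCurve (2 * (p₁ * p₂ * p₃))).analyticRank = 1 ∧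
    ∃ x : ℚ, x ≠ 0 ∧ padicValRat 2 x = 4 ∧
      deriv (congruentNumberCurve (2 * (p₁ * p₂ * p₃))).entireLFunction 1 =
        (x : ℂ) * ((congruentNumberCurve (2 * (p₁ * p₂ * p₃))).realPeriodRat : ℂ) *
          ((congruentNumberCurve (2 * (p₁ * p₂ * p₃))).regulator : ℂ) := by
  have hsq := squarefree_two_mul_557 hp₁ hp₂ hp₃ h₁ h₂ h₃ h12
  haveI := isElliptic_congruentNumberCurve hsq.ne_zero
  have h12m : (p₁ * p₂) % 8 = 1 := by rw [Nat.mul_mod, h₁, h₂]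
  have hm7 : (p₁ * p₂ * p₃) % 8 = 7 := by rw [Nat.mul_mod, h12m, h₃]
  have hn6 : (2 * (p₁ * p₂ * p₃)) % 8 = 6 := by omega
  obtain ⟨L, hLodd, hL⟩ := exists_odd_isScriptL_two_mul_557_of_cmPointGaloisData hCM hGZK hp₁ hp₂ hp₃ h₁ h₂ h₃ h12 hg
  have hL0' : L ≠ 0 := fun h => by simp [h] at hLodd
  have hL0 : (L : ℚ) ≠ 0 := by exact_mod_cast hL0'
  have hr1 := analyticRank_congruentNumberCurve_eq_one_of_isScriptL hsq (Or.inr (Or.inl hn6)) hL hL0'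
  -- `twoExponent n = 4`
  have ht : ∀ i, ((![p₁, p₂, p₃] : Fin 3 → ℕ) i).Prime := fun i => by fin_cases i <;> assumption
  have hodd : ∀ i, Odd ((![p₁, p₂, p₃] : Fin 3 → ℕ) i) := fun i => by
    fin_cases i <;> exact Nat.odd_iff.mpr (by simp; omega)
  have h13 : p₁ ≠ p₃ := fun h => by omega
  have h23 : p₂ ≠ p₃ := fun h => by omega
  have hinj : Function.Injective (![p₁, p₂, p₃] : Fin 3 → ℕ) := by
    intro i j h
    fin_cases i <;> fin_cases j <;> simp_all
  have he : twoExponent (2 * (p₁ * p₂ * p₃)) = 4 := by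
    have h := twoExponent_two_mul_prod_eq _ ht hodd hinj
    rw [Fin.prod_univ_three] at h
    norm_num at h
    exact h
  refine ⟨hr1, (2 : ℚ) ^ twoExponent (2 * (p₁ * p₂ * p₃)) * (L : ℚ) ^ 2,
    mul_ne_zero (zpow_ne_zero _ two_ne_zero) (pow_ne_zero _ hL0), ?_, ?_⟩
  · rw [padicValRat_two_zpow_mul_sq hLodd, he]
  · rw [← (leadingLCoeff_eq_deriv_of_analyticRank_eq_one hr1).1,
      leadingLCoeff_congruentNumberCurve_eq_of_isScriptL (Nat.pos_of_ne_zero hsq.ne_zero) hr1 hL]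
    push_cast
    ring

/-- **`ord_{s=1} L = 1`, rank `1`, `Ш[2^∞] = 0` and `BSD(E_n, 2)` for the type `(5, 5, 7)` with `g(n)` odd and Monsky's
`s(n) = 1`**, relative to {`tyz_cmPointGaloisData`, GZK, `hMe` = Monsky's even `2`-descent matrix theorem}: the rank-one datum
above (`ord₂ x = 4 = 2·3 − 2`) through the landed even door `rankOne_sha_bsdp_two_iff_congruentNumberCurve_two_mul_pqr`. The
Selmer input `s(n) = monskySelmerRankEven ![p₁, p₂, p₃] = 1` is kernel-decidable per pair / per symbol type (companion file).
CONDITIONAL; nothing asserted; closes no class by itself.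
[cite: TianYuanZhang2017, §1 (1.1), Thm. 3.5] [cite: HeathBrown1994SelmerCongruentII, Appendix (Monsky), typescript p. 41 L20–L36]
[cite: Miller2011LMS, Def. 1.1 (arXiv:1010.2431 p. 3)] -/
theorem rankOne_sha_bsdp_two_two_mul_557_of_cmPointGaloisData (hCM : tyz_cmPointGaloisData)
    (hGZK : rank_eq_analyticRank_of_analyticRank_le_one) (hMe : monsky_card_selmerGroup_two_even)
    (hp₁ : p₁.Prime) (hp₂ : p₂.Prime) (hp₃ : p₃.Prime) (h₁ : p₁ % 8 = 5) (h₂ : p₂ % 8 = 5) (h₃ : p₃ % 8 = 7)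
    (h12 : p₁ ≠ p₂) (hg : Odd (gK (2 * (p₁ * p₂ * p₃)))) (hs : monskySelmerRankEven ![p₁, p₂, p₃] = 1) :
    (congruentNumberCurve (2 * (p₁ * p₂ * p₃))).analyticRank = 1 ∧
      (congruentNumberCurve (2 * (p₁ * p₂ * p₃))).mordellWeilRank = 1 ∧
      AddCommGroup.primaryComponent (congruentNumberCurve (2 * (p₁ * p₂ * p₃))).sha 2 = ⊥ ∧
      BSDp (congruentNumberCurve (2 * (p₁ * p₂ * p₃))) 2 := by
  have h12m : (p₁ * p₂) % 8 = 1 := by rw [Nat.mul_mod, h₁, h₂]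
  have hm7 : (p₁ * p₂ * p₃) % 8 = 7 := by rw [Nat.mul_mod, h12m, h₃]
  have hn6 : (2 * (p₁ * p₂ * p₃)) % 8 = 6 := by omega
  have h13 : p₁ ≠ p₃ := fun h => by omega
  have h23 : p₂ ≠ p₃ := fun h => by omega
  obtain ⟨-, x, hx0, hv, hx⟩ :=
    rankOneDatum_two_mul_557_of_cmPointGaloisData hCM hGZK hp₁ hp₂ hp₃ h₁ h₂ h₃ h12 hg
  obtain ⟨hr1, hrk, hsha, hiff⟩ :=
    rankOne_sha_bsdp_two_iff_congruentNumberCurve_two_mul_pqr hGZK hMe hp₁ hp₂ hp₃ h12 h13 h23 hn6 hs hx0 hx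
  exact ⟨hr1, hrk, hsha, hiff.mpr hv⟩

end Doors
end ThetaDescent

end Summit.BirchSwinnertonDyer.Rank1Residual.P2

end
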